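import Summits.RiemannHypothesis.RiemannHypothesis.Theorems.UniversalFactorMixedFactorReduction
import Literature.NumberTheory.LFunctions.DobnerLemma4Proofs

/-!
# RiemannHypothesis / UniversalFactor — the Laplace ray carries the whole universal-factor loophole

Route `RiemannHypothesis/UniversalFactor`. The thesis states that, by `MixedFactorReduction`
(item stmt-RiemannHypothesis-2580, `UniversalFactor.mixedFactorReduction`) together with Newman's
conjecture `Λ ≥ 0` (`rodgers_tao_holds`, proved in tree along Dobner), the target
`LaplaceLoophole` (Cardon's Question 7 on the minimal non-Gaussian universal factors
`1 + u²/a²`) "is the whole universal-factor loophole". This file makes that sentence a theorem: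

* `UniversalFactor.not_hasOnlyRealZeros_universalFactor_of_not_laplaceLoophole`: if no `F_a`
  is real-rooted, then for EVERY non-trivial finite universal factor
  `S(u) = e^{tu²} ∏_{b∈s} (1 + u²/b²)` (`t ≥ 0`, rates `b > 0`, `s ≠ ∅` or `t > 0`) the divided
  transform `∫₀^∞ (Φ(u)/S(u)) cos(zu) du` has a non-real zero (for `s = ∅` this is `H_{−t}`,
  `t > 0`, and the claim is `Λ ≥ 0`);
* `UniversalFactor.not_laplaceLoophole_iff_universalFactorNewman`: the equivalence
  `¬ LaplaceLoophole ↔` generalised Newman on the whole finite cone (the converse is the special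
  case `t = 0`, `s = {a}`).

So the route's expected end state (kill criterion (ii): the four no-go cruxes refute
`LaplaceLoophole`) is literally "GN holds on the whole universal-factor cone".

References: N. G. de Bruijn, Duke Math. J. 17 (1950), §1 and Thm. 13; B. Rodgers, T. Tao,
Forum Math. Pi 8 (2020), Thm. 1.1; D. A. Cardon, Proc. AMS 130 (2002), §3 Q. 7.
-/

noncomputable section

namespace Summit.RiemannHypothesis.RiemannHypothesis.Theorems

open MeasureTheory Set Filter
open Literature.NumberTheory.LFunctions Literature.Analysis.Complex
open Summit.RiemannHypothesis.RiemannHypothesis.Theses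

/-- For the EMPTY multiset of rates the mixed kernel `e^{−tu²} Φ(u) / ∏_{b∈∅}(1 + u²/b²)` is de
Bruijn's kernel of `H_{−t}`: the divided transform is `deBruijnH (−t)`. [folklore] -/
theorem UniversalFactor.mixedTransform_zero_eq_deBruijnH (t : ℝ) :
    (fun z : ℂ => ∫ u in Set.Ioi (0:ℝ), ((Real.exp (-(t * u ^ 2)) * deBruijnPhi u /
      ((0 : Multiset ℝ).map fun b => 1 + u ^ 2 / b ^ 2).prod : ℝ) : ℂ) * Complex.cos (z * u)) =
      deBruijnH (-t) := by
  funext z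
  rw [deBruijnH]
  refine setIntegral_congr_fun measurableSet_Ioi fun u _ ↦ ?_
  simp only [Multiset.map_zero, Multiset.prod_zero, div_one, neg_mul]
  push_cast
  ring

/-- For `t = 0` and the singleton multiset `{a}` the mixed kernel is `Φ(u)/(1 + u²/a²)`: the
divided transform is the Laplace-smoothed `F_a`. [folklore] -/
theorem UniversalFactor.mixedTransform_singleton_eq (a : ℝ) :
    (fun z : ℂ => ∫ u in Set.Ioi (0:ℝ), ((Real.exp (-(0 * u ^ 2)) * deBruijnPhi u /
      (({a} : Multiset ℝ).map fun b => 1 + u ^ 2 / b ^ 2).prod : ℝ) : ℂ) * Complex.cos (z * u)) =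
      fun z : ℂ => ∫ u in Set.Ioi (0:ℝ), ((deBruijnPhi u / (1 + u ^ 2 / a ^ 2) : ℝ) : ℂ) *
        Complex.cos (z * u) := by
  funext z
  refine setIntegral_congr_fun measurableSet_Ioi fun u _ ↦ ?_
  simp only [zero_mul, neg_zero, Real.exp_zero, one_mul, Multiset.map_singleton,
    Multiset.prod_singleton]

/-- **No Laplace loophole ⇒ generalised Newman on the whole finite universal-factor cone.**
If no Laplace-smoothed transform `F_a` (`a > 0`) has only real zeros, then for every `t ≥ 0`
and every multiset `s` of positive rates with `s ≠ ∅` or `t > 0`, the transform of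
`e^{−tu²} Φ(u) / ∏_{b∈s}(1 + u²/b²)` — the de Bruijn transform of `Φ` divided by the universal
factor `S(u) = e^{tu²}∏(1 + u²/b²)` — has a non-real zero. For `s ∋ a` this is
`MixedFactorReduction` (real-rootedness would propagate up to `F_a`); for `s = ∅`, `t > 0`, the
transform is `H_{−t}` and the claim is `Λ ≥ 0` (`rodgers_tao_holds`). [folklore] -/
theorem UniversalFactor.not_hasOnlyRealZeros_universalFactor_of_not_laplaceLoophole
    (hX : ¬ UniversalFactor.LaplaceLoophole) {t : ℝ} (ht : 0 ≤ t) {s : Multiset ℝ}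
    (hs : ∀ b ∈ s, 0 < b) (hst : s ≠ 0 ∨ 0 < t) :
    ¬ HasOnlyRealZeros (fun z : ℂ => ∫ u in Set.Ioi (0:ℝ), ((Real.exp (-(t * u ^ 2)) *
      deBruijnPhi u / (s.map fun b => 1 + u ^ 2 / b ^ 2).prod : ℝ) : ℂ) * Complex.cos (z * u)) := by
  intro hreal
  rcases eq_or_ne s 0 with rfl | hs0
  · -- pure Gaussian ray: `H_{−t}` with `−t < 0` has a non-real zero (`Λ ≥ 0`)
    have ht0 : 0 < t := hst.resolve_left (fun h ↦ h rfl)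
    rw [UniversalFactor.mixedTransform_zero_eq_deBruijnH] at hreal
    exact rodgers_tao_holds (-t) (by linarith) hreal
  · -- a Laplace factor is present: propagate real-rootedness up to `F_a`
    obtain ⟨a, ha⟩ := Multiset.exists_mem_of_ne_zero hs0
    exact hX ⟨a, hs a ha, UniversalFactor.mixedFactorReduction t a s ht ha hs hreal⟩

/-- **`¬ LaplaceLoophole` ↔ generalised Newman on the whole finite universal-factor cone**
(route `UniversalFactor`: "by MixedFactorReduction + `Λ ≥ 0` the Laplace ray is the whole
universal-factor loophole"). The forward direction is
`UniversalFactor.not_hasOnlyRealZeros_universalFactor_of_not_laplaceLoophole`; the converse is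
the special case `t = 0`, `s = {a}`. [folklore] -/
theorem UniversalFactor.not_laplaceLoophole_iff_universalFactorNewman :
    ¬ UniversalFactor.LaplaceLoophole ↔
      ∀ (t : ℝ) (s : Multiset ℝ), 0 ≤ t → (∀ b ∈ s, 0 < b) → (s ≠ 0 ∨ 0 < t) →
        ¬ HasOnlyRealZeros (fun z : ℂ => ∫ u in Set.Ioi (0:ℝ), ((Real.exp (-(t * u ^ 2)) *
          deBruijnPhi u / (s.map fun b => 1 + u ^ 2 / b ^ 2).prod : ℝ) : ℂ) *
            Complex.cos (z * u)) := by
  constructor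
  · intro hX t s ht hs hst
    exact UniversalFactor.not_hasOnlyRealZeros_universalFactor_of_not_laplaceLoophole hX ht hs hst
  · rintro h ⟨a, ha, hFa⟩
    refine h 0 {a} le_rfl (fun b hb ↦ ?_) (Or.inl (Multiset.singleton_ne_zero a)) ?_
    · rw [Multiset.mem_singleton.1 hb]; exact ha
    · rw [UniversalFactor.mixedTransform_singleton_eq a]
      exact hFa

end Summit.RiemannHypothesis.RiemannHypothesis.Theorems
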